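import Summits.HodgeConjecture.CorCM.GaloisCyclicSemidirectEightTwoSheet
import Summits.HodgeConjecture.CorCM.GaloisDicyclicNondegenerate
import HarnessLib

/-!
# Galois CM fields with group `C_p ⋊ C₈`: every primitive CM type is nondegenerate as soon as `±i` is not a norm from
# `ℚ(ζ_{4p})` to `ℚ(i, ζ_p + ζ_p⁻¹)` — the Hodge conjecture for all powers of their simple CM abelian `4p`-folds

COR-CM (cell `pub-hodgecm2`), binder seat b04 (gen 25), count-neutral claim CYCLIC-SEMIDIRECT-EIGHT, part II (the theorem on
CM fields; part I `CorCM/GaloisCyclicSemidirectEightTwoSheet` is the group-theoretic core, part III supplies the arithmetic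
hypothesis for `p ≡ 5 (mod 8)`).  KERNEL ONLY: theorems; no definition, no named fact, no `sorry`.  `HC_CM` is neither used
nor claimed: this is the Hodge conjecture for a NAMED CLASS of CM abelian varieties, modulo ONE explicit, elementary field
hypothesis.

SETTING.  `K` a Galois CM field with `Gal(K/ℚ) ≅ C_p ⋊ C₈ = ⟨u, y | u^p = y⁸ = 1, y u y⁻¹ = u⁻¹⟩`, `p` an odd prime
(Mathlib model `Multiplicative (ZMod p) ⋊[φ] Multiplicative (ZMod 8)`, `φ(1)` = inversion): `K` is the compositum of a
cyclic octic CM field `L = K^{⟨u⟩}` and a dihedral field `K^{⟨y²⟩}` of degree `2p`; `[K:ℚ] = 8p`; complex conjugation is the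
UNIQUE involution `y⁴`.  This is the second family of gen 20's list (iii) «groups with a unique involution and cyclic Sylow
`2`-subgroup» (the first, `Q₈ × C_p`, is QUATERNION-CYCLIC-PRIME); neither has skew CM sets (gen 23), so their status is
arithmetic: the two-sheet determinant of part I is `N(z₁) − ω N(z₂)` with `N` the norm of `ℚ(ζ_{4p}) / ℚ(i, ζ_p + ζ_p⁻¹)` and
`ω = ±i`.

THEOREM (`isNondegenerate_of_isPrimitive_cyclicSemidirectEight`).  If `±i` is not a quotient of two such norms (hypothesis
`hN`, stated for a subfield `M ⊆ ℂ` containing `μ_{4p}` and a ring map `ρ : M → ℂ` fixing `μ₄` and inverting `μ_p`; by part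
III it holds iff `p ≡ 5 (mod 8)` — `p = 5, 13, 29, 37, 53, 61, …`), then EVERY PRIMITIVE CM type of `K` is NONDEGENERATE (rank
`4p + 1`), hence every SIMPLE abelian variety of dimension `4p` with complex multiplication by `K` satisfies
`Bᵐ(Aⁿ) ⊗ ℂ = Dᵐ(Aⁿ) ⊗ ℂ` and the HODGE CONJECTURE together with ALL ITS POWERS.  Sharp: `C₃ ⋊ C₈` (order 24, gen 20 table
model) and `C₇ ⋊ C₈` (seat census) carry primitive degenerate types.

* §1 `map_complexConj_eq`, `finrank_eq`.
* §2 **`isNondegenerate_of_isPrimitive_cyclicSemidirectEight`**, `cmTypeRank_eq_of_isPrimitive_cyclicSemidirectEight`.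
* §3 `hodgeConjectureFor_pow_of_isSimple_cyclicSemidirectEight`, `hodgeConjectureFor_of_isSimple_cyclicSemidirectEight`,
  `hodgeClassSpan_pow_eq_divisorClassesSpan_of_isSimple_cyclicSemidirectEight`, `dim_eq_of_cyclicSemidirectEight`.

## References

* [Kubota1965] T. Kubota, Trans. AMS 118 (1965), §2 (rank; nondegenerate ⟹ primitive), §4 Lemma 2.
* [Dodson1984] B. Dodson, *The structure of Galois groups of CM-fields*, Trans. AMS 283 (1984), §3.1, §5.3.
* [Shimura1998] G. Shimura, *Abelian Varieties with Complex Multiplication and Modular Functions*, §8.2 Prop. 26.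
* [Gordon1999HodgeAVSurvey] B. B. Gordon, *A survey of the Hodge conjecture for abelian varieties*, Thm. 6.4, §9.4.
-/

noncomputable section

open CategoryTheory CategoryTheory.Limits NumberField
open scoped BigOperators

namespace Summit.HodgeConjecture.CorCM.GaloisCyclicSemidirectEight

open Literature.NumberTheory.ComplexMultiplication
open Literature.AlgebraicGeometry.Motives (AbelianVariety CMType)
open Literature.AlgebraicGeometry.HodgeTheory
open Literature.AlgebraicGeometry.ComplexMultiplication (IsCMTypeRealisation isSimple_iff_isPrimitive)
open Literature.AlgebraicGeometry.Pohlmann1968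
open Summit.HodgeConjecture.CorCM.GaloisRank

/-! ## §1 Complex conjugation and the degree -/

section Involution

variable {p : ℕ} [Fact p.Prime]
variable (φ : Multiplicative (ZMod 8) →* MulAut (Multiplicative (ZMod p)))
  (hφ : ∀ v : Multiplicative (ZMod p), φ (Multiplicative.ofAdd 1) v = v⁻¹)
variable {K : Type} [Field K] [NumberField K] [IsCMField K]

include hφ in
/-- Complex conjugation maps to `y⁴ = inr 4` under any isomorphism `Gal(K/ℚ) ≃ C_p ⋊ C₈`. [folklore] -/
theorem map_complexConj_eq (hp2 : p ≠ 2) (e : (K ≃ₐ[ℚ] K) ≃* Multiplicative (ZMod p) ⋊[φ] Multiplicative (ZMod 8)) :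
    e ((IsCMField.complexConj K).restrictScalars ℚ) = SemidirectProduct.inr (Multiplicative.ofAdd 4) :=
  involution_eq φ hφ Fact.out hp2 _ (model_complexConj_mul_self e rfl) (model_complexConj_ne_one e rfl)

omit [IsCMField K] in
/-- `[K:ℚ] = 8p`. [folklore] -/
theorem finrank_eq [IsGalois ℚ K] (e : (K ≃ₐ[ℚ] K) ≃* Multiplicative (ZMod p) ⋊[φ] Multiplicative (ZMod 8)) :
    Module.finrank ℚ K = 8 * p := by
  have hp : p.Prime := Fact.out
  haveI : NeZero p := ⟨hp.ne_zero⟩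
  haveI : Fintype (Multiplicative (ZMod p) ⋊[φ] Multiplicative (ZMod 8)) :=
    Fintype.ofEquiv _ SemidirectProduct.equivProd.symm
  rw [← card_model_eq_finrank e, card_eq]

end Involution

/-! ## §2 Nondegeneracy -/

section Field

variable {p : ℕ} [Fact p.Prime]
variable {K : Type} [Field K] [NumberField K] [IsCMField K] [IsGalois ℚ K]

/-- **THEOREM.  `Gal(K/ℚ) ≅ C_p ⋊ C₈` (`p` an odd prime, `φ(1)` = inversion) and `±i` is not a quotient of norms
`z ρ(z)` for a subfield `M ⊆ ℂ` containing `μ_{4p}` and a ring map `ρ : M → ℂ` fixing `μ₄` and inverting `μ_p` (e.g.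
`M = ℚ(ζ_{4p})`, `p ≡ 5 (mod 8)`): every PRIMITIVE CM type of `K` is NONDEGENERATE.**  A vanishing two-sheet determinant
`N(z₁) − ω N(z₂)` would make `u⁴ ≠ 1` a left stabiliser of the type read on `C_p ⋊ C₈`, contradicting primitivity.
[cite: Kubota1965, §4 Lemma 2] [cite: Shimura1998, §8.2 Prop. 26] -/
theorem isNondegenerate_of_isPrimitive_cyclicSemidirectEight (hp2 : p ≠ 2)
    (φ : Multiplicative (ZMod 8) →* MulAut (Multiplicative (ZMod p)))
    (hφ : ∀ v : Multiplicative (ZMod p), φ (Multiplicative.ofAdd 1) v = v⁻¹)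
    (M : Subfield ℂ) (ρ : M →+* ℂ) (hM : ∀ z : ℂ, z ^ (4 * p) = 1 → z ∈ M)
    (hρ4 : ∀ z : M, (z : ℂ) ^ 4 = 1 → ρ z = z) (hρp : ∀ z : M, (z : ℂ) ^ p = 1 → ρ z = (z : ℂ)⁻¹)
    (hN : ∀ (z₁ z₂ : M) (ω : ℂ), ω ^ 2 = -1 → (z₁ : ℂ) * ρ z₁ = ω * ((z₂ : ℂ) * ρ z₂) →
      (z₁ : ℂ) = 0 ∧ (z₂ : ℂ) = 0)
    (e : (K ≃ₐ[ℚ] K) ≃* Multiplicative (ZMod p) ⋊[φ] Multiplicative (ZMod 8)) {Φ : CMType K} (φ₀ : K →+* ℂ)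
    (hprim : IsPrimitive (ℂ ≃+* ℂ) Φ.1 φ₀) : IsNondegenerate Φ := by
  classical
  have hp : p.Prime := Fact.out
  haveI : NeZero p := ⟨hp.ne_zero⟩
  haveI : Fintype (Multiplicative (ZMod p) ⋊[φ] Multiplicative (ZMod 8)) :=
    Fintype.ofEquiv _ SemidirectProduct.equivProd.symm
  have hc := map_complexConj_eq φ hφ hp2 e
  set S : Finset (Multiplicative (ZMod p) ⋊[φ] Multiplicative (ZMod 8)) :=
    Finset.univ.filter fun y => embOf φ₀ (e.symm y) ∈ Φ.1 with hS_def
  have hS : ∀ y, y ∈ S ↔ embOf φ₀ (e.symm y) ∈ Φ.1 := fun y => by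
    simp only [hS_def, Finset.mem_filter, Finset.mem_univ, true_and]
  have hScm := model_mul_mem_iff e hc Φ φ₀ S hS
  -- `u⁴ = inl 4 ≠ 1` is not a left stabiliser (primitivity)
  have hv1 : (SemidirectProduct.inl (Multiplicative.ofAdd (4 : ZMod p)) :
      Multiplicative (ZMod p) ⋊[φ] Multiplicative (ZMod 8)) ≠ 1 := by
    intro h
    rw [← map_one (SemidirectProduct.inl : Multiplicative (ZMod p) →* _), SemidirectProduct.inl_inj] at h
    have h4 : (4 : ZMod p) = 0 := by
      have := congrArg Multiplicative.toAdd h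
      simpa using this
    rw [show (4 : ZMod p) = ((2 ^ 2 : ℕ) : ZMod p) by norm_num, ZMod.natCast_eq_zero_iff] at h4
    exact hp2 ((Nat.prime_dvd_prime_iff_eq hp Nat.prime_two).1 (hp.dvd_of_dvd_pow h4))
  have hstab : ¬ ∀ w : Multiplicative (ZMod p) ⋊[φ] Multiplicative (ZMod 8),
      w ∈ S ↔ SemidirectProduct.inl (Multiplicative.ofAdd (4 : ZMod p)) * w ∈ S :=
    fun h => not_isPrimitive_of_leftStabiliser e Φ φ₀ S hS hv1 h hprim
  exact (isNondegenerate_iff_forall_annihilator e hc Φ φ₀ S hS).2 fun b hb hann =>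
    eq_zero_of_annihilated_cyclicSemidirectEight hp2 φ hφ M ρ hM hρ4 hρp hN S hScm hstab b hb hann

/-- The rank: `cmTypeRank Φ = 4p + 1`. [cite: Kubota1965, §2 (p. 115)] -/
theorem cmTypeRank_eq_of_isPrimitive_cyclicSemidirectEight (hp2 : p ≠ 2)
    (φ : Multiplicative (ZMod 8) →* MulAut (Multiplicative (ZMod p)))
    (hφ : ∀ v : Multiplicative (ZMod p), φ (Multiplicative.ofAdd 1) v = v⁻¹)
    (M : Subfield ℂ) (ρ : M →+* ℂ) (hM : ∀ z : ℂ, z ^ (4 * p) = 1 → z ∈ M)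
    (hρ4 : ∀ z : M, (z : ℂ) ^ 4 = 1 → ρ z = z) (hρp : ∀ z : M, (z : ℂ) ^ p = 1 → ρ z = (z : ℂ)⁻¹)
    (hN : ∀ (z₁ z₂ : M) (ω : ℂ), ω ^ 2 = -1 → (z₁ : ℂ) * ρ z₁ = ω * ((z₂ : ℂ) * ρ z₂) →
      (z₁ : ℂ) = 0 ∧ (z₂ : ℂ) = 0)
    (e : (K ≃ₐ[ℚ] K) ≃* Multiplicative (ZMod p) ⋊[φ] Multiplicative (ZMod 8)) {Φ : CMType K} (φ₀ : K →+* ℂ)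
    (hprim : IsPrimitive (ℂ ≃+* ℂ) Φ.1 φ₀) : cmTypeRank Φ = 4 * p + 1 := by
  have h := isNondegenerate_of_isPrimitive_cyclicSemidirectEight hp2 φ hφ M ρ hM hρ4 hρp hN e φ₀ hprim
  rw [isNondegenerate_iff, finrank_eq φ e] at h
  rw [h]; omega

end Field

/-! ## §3 The Hodge conjecture for the simple CM abelian varieties and their powers -/

section Geometry

variable {p : ℕ} [Fact p.Prime]
variable {K : Type} [Field K] [NumberField K] [IsCMField K] [IsGalois ℚ K]
variable {Φ : CMType K} {A : AbelianVariety ℂ} {ι : 𝓞 K →+* End A}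
  {θ : K →+* Module.End ℂ (complexBetti A.X 1)}

/-- **THE HODGE CONJECTURE FOR EVERY POWER OF EVERY SIMPLE ABELIAN VARIETY (of dimension `4p`) WITH COMPLEX
MULTIPLICATION BY A GALOIS CM FIELD WITH GROUP `C_p ⋊ C₈`** (`p` an odd prime), provided `±i` is not a quotient of norms
`z ρ(z)` as above (e.g. `p ≡ 5 (mod 8)`). [cite: Gordon1999HodgeAVSurvey, Thm. 6.4] [cite: Shimura1998, §8.2 Prop. 26] -/
theorem hodgeConjectureFor_pow_of_isSimple_cyclicSemidirectEight (hp2 : p ≠ 2)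
    (φ : Multiplicative (ZMod 8) →* MulAut (Multiplicative (ZMod p)))
    (hφ : ∀ v : Multiplicative (ZMod p), φ (Multiplicative.ofAdd 1) v = v⁻¹)
    (M : Subfield ℂ) (ρ : M →+* ℂ) (hM : ∀ z : ℂ, z ^ (4 * p) = 1 → z ∈ M)
    (hρ4 : ∀ z : M, (z : ℂ) ^ 4 = 1 → ρ z = z) (hρp : ∀ z : M, (z : ℂ) ^ p = 1 → ρ z = (z : ℂ)⁻¹)
    (hN : ∀ (z₁ z₂ : M) (ω : ℂ), ω ^ 2 = -1 → (z₁ : ℂ) * ρ z₁ = ω * ((z₂ : ℂ) * ρ z₂) →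
      (z₁ : ℂ) = 0 ∧ (z₂ : ℂ) = 0)
    (e : (K ≃ₐ[ℚ] K) ≃* Multiplicative (ZMod p) ⋊[φ] Multiplicative (ZMod 8)) (hA : IsCMTypeRealisation Φ A ι θ)
    (hs : A.IsSimple) (N : ℕ) :
    HodgeConjectureFor (⨁ fun _ : Fin N => A).dim (⨁ fun _ : Fin N => A).X := by
  obtain ⟨φ₀⟩ := (inferInstance : Nonempty (K →+* ℂ))
  exact (isNondegenerate_of_isPrimitive_cyclicSemidirectEight hp2 φ hφ M ρ hM hρ4 hρp hN e φ₀
    ((isSimple_iff_isPrimitive hA φ₀).1 hs)).hodgeConjectureFor_pow hA N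

/-- The Hodge conjecture for the simple abelian variety itself. [cite: Gordon1999HodgeAVSurvey, Thm. 6.4] -/
theorem hodgeConjectureFor_of_isSimple_cyclicSemidirectEight (hp2 : p ≠ 2)
    (φ : Multiplicative (ZMod 8) →* MulAut (Multiplicative (ZMod p)))
    (hφ : ∀ v : Multiplicative (ZMod p), φ (Multiplicative.ofAdd 1) v = v⁻¹)
    (M : Subfield ℂ) (ρ : M →+* ℂ) (hM : ∀ z : ℂ, z ^ (4 * p) = 1 → z ∈ M)
    (hρ4 : ∀ z : M, (z : ℂ) ^ 4 = 1 → ρ z = z) (hρp : ∀ z : M, (z : ℂ) ^ p = 1 → ρ z = (z : ℂ)⁻¹)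
    (hN : ∀ (z₁ z₂ : M) (ω : ℂ), ω ^ 2 = -1 → (z₁ : ℂ) * ρ z₁ = ω * ((z₂ : ℂ) * ρ z₂) →
      (z₁ : ℂ) = 0 ∧ (z₂ : ℂ) = 0)
    (e : (K ≃ₐ[ℚ] K) ≃* Multiplicative (ZMod p) ⋊[φ] Multiplicative (ZMod 8)) (hA : IsCMTypeRealisation Φ A ι θ)
    (hs : A.IsSimple) : HodgeConjectureFor A.dim A.X := by
  obtain ⟨φ₀⟩ := (inferInstance : Nonempty (K →+* ℂ))
  exact (isNondegenerate_of_isPrimitive_cyclicSemidirectEight hp2 φ hφ M ρ hM hρ4 hρp hN e φ₀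
    ((isSimple_iff_isPrimitive hA φ₀).1 hs)).hodgeConjectureFor hA

/-- `Bᵐ(Aⁿ) ⊗ ℂ = Dᵐ(Aⁿ) ⊗ ℂ` on every power of such a simple abelian variety (White–Hazama).
[cite: Gordon1999HodgeAVSurvey, §9.3] -/
theorem hodgeClassSpan_pow_eq_divisorClassesSpan_of_isSimple_cyclicSemidirectEight (hp2 : p ≠ 2)
    (φ : Multiplicative (ZMod 8) →* MulAut (Multiplicative (ZMod p)))
    (hφ : ∀ v : Multiplicative (ZMod p), φ (Multiplicative.ofAdd 1) v = v⁻¹)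
    (M : Subfield ℂ) (ρ : M →+* ℂ) (hM : ∀ z : ℂ, z ^ (4 * p) = 1 → z ∈ M)
    (hρ4 : ∀ z : M, (z : ℂ) ^ 4 = 1 → ρ z = z) (hρp : ∀ z : M, (z : ℂ) ^ p = 1 → ρ z = (z : ℂ)⁻¹)
    (hN : ∀ (z₁ z₂ : M) (ω : ℂ), ω ^ 2 = -1 → (z₁ : ℂ) * ρ z₁ = ω * ((z₂ : ℂ) * ρ z₂) →
      (z₁ : ℂ) = 0 ∧ (z₂ : ℂ) = 0)
    (e : (K ≃ₐ[ℚ] K) ≃* Multiplicative (ZMod p) ⋊[φ] Multiplicative (ZMod 8)) (hA : IsCMTypeRealisation Φ A ι θ)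
    (hs : A.IsSimple) (N m : ℕ) :
    Literature.AlgebraicGeometry.VanGeemen1994.hodgeClassSpan (⨁ fun _ : Fin N => A).dim (⨁ fun _ : Fin N => A).X m =
      Literature.Barriers.HodgeConjecture.divisorClassesSpan (⨁ fun _ : Fin N => A).X
        (⨁ fun _ : Fin N => A).dim m := by
  obtain ⟨φ₀⟩ := (inferInstance : Nonempty (K →+* ℂ))
  exact (isNondegenerate_of_isPrimitive_cyclicSemidirectEight hp2 φ hφ M ρ hM hρ4 hρp hN e φ₀
    ((isSimple_iff_isPrimitive hA φ₀).1 hs)).hodgeClassSpan_pow_eq_divisorClassesSpan hA N m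

omit [IsCMField K] in
/-- … and such a simple abelian variety has dimension `4p`. [cite: Shimura1998, §8.2 Prop. 26] -/
theorem dim_eq_of_cyclicSemidirectEight (φ : Multiplicative (ZMod 8) →* MulAut (Multiplicative (ZMod p)))
    (e : (K ≃ₐ[ℚ] K) ≃* Multiplicative (ZMod p) ⋊[φ] Multiplicative (ZMod 8)) (hA : IsCMTypeRealisation Φ A ι θ) :
    A.dim = 4 * p := by
  have h : A.dim = Module.finrank ℚ K / 2 := Literature.AlgebraicGeometry.Motives.schemeDim_eq_holds hA.1
  rw [finrank_eq φ e] at h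
  omega

end Geometry

end Summit.HodgeConjecture.CorCM.GaloisCyclicSemidirectEight

end
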